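import Summits.KontsevichZagierPeriods.KontsevichZagierPeriods.Theorems.BetaCancellation.Negative.PiLinkReps
import Literature.NumberTheory.Transcendental.KZSemialgebraicComplex
import Literature.NumberTheory.Transcendental.KZLogCalculusProofs

/-!
# `BetaCancellation` (stmt-KontsevichZagierPeriods-13633) — line `dirichlet-companion-to-pi`,
stub `stub_affineMove`

Step 3 of the one-dimensional proof of Euler reflection inside the Kontsevich–Zagier calculus
(item stmt-KontsevichZagierPeriods-3383): each partial-fraction term `κ·s/(x² − 2cx + 1)` on `(0,1)`,
with `(c, s) = (cos θ, sin θ)`, `s > 0`, `c² + s² = 1`, BOTH real algebraic, is carried to the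
arctan-type integrand `κ/(1 + m²)` on the interval `((0−c)/s, (1−c)/s)` of the `m`-line by the affine
substitution `x = s·m + c` (i.e. `m = (x − c)/s`). This is ONE change-of-variables move (rule (2) of
the calculus, `KZ.changeOfVariablesRel`) with SOURCE the `m`-representation `A`, chart
`Φ m = s·m + c` (semialgebraic over `ℚ` because its two coefficients are real algebraic numbers,
`isSemialgebraicFunOn_const_of_isAlgebraic`; increasing, hence injective; derivative `s • id` of
absolute determinant `s`) and IMAGE the `x`-representation `T`:

* `Φ` maps `((0−c)/s, (1−c)/s)` onto `(0,1)` (`aff_image_chart`);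
* the pull-back identity `κ/(1+m²) = κ s/((sm+c)² − 2c(sm+c) + 1) · s`, because
  `(sm+c)² − 2c(sm+c) + 1 = s²m² + 1 − c² = s²(1 + m²)` (`aff_kernel_identity`).

Hence `[A] − [T] ∈ changeOfVariablesRel`, so `KZ.Equivalent A T`, and `KZ.Equivalent T A` by
symmetry (`stub_affineMove`). Pattern of `Negative/PiLinkReps.lean` (`halfAffine`) and of
`TerasomaMultiplicationBetaCancellationStubDirichletLinear.lean`; no definitions are introduced
(the chart and its derivative are written out), so that the file is a pure proof file.

References: M. Kontsevich, D. Zagier, *Periods* (2001), §1.2 rule (2).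
-/

noncomputable section

-- `Summit.KontsevichZagierPeriods.KontsevichZagierPeriods.…` is the tree's mandated layout (single-conjunct summit).
set_option linter.dupNamespace false

namespace Summit.KontsevichZagierPeriods.KontsevichZagierPeriods.BetaCancellationLine

open MeasureTheory Set
open Literature.NumberTheory.Transcendental
open Literature.NumberTheory.Transcendental.KZ
open Literature.ModelTheory.ExponentialFields (IsSemialgebraic)
open MvPolynomial (aeval X C)

/-! ## The pull-back identity -/

/-- The denominator of the partial-fraction term after the substitution `x = s·m + c`:
`(sm+c)² − 2c(sm+c) + 1 = s²(1 + m²)` when `c² + s² = 1`. [folklore] -/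
theorem aff_denominator_eq {c s : ℝ} (h : c ^ 2 + s ^ 2 = 1) (m : ℝ) :
    (s * m + c) ^ 2 - 2 * c * (s * m + c) + 1 = s ^ 2 * (1 + m ^ 2) := by
  linear_combination (-1 : ℝ) * h

/-- **The pull-back identity** of the affine chart (Jacobian `s` included):
`κ/(1+m²) = κ s/((sm+c)² − 2c(sm+c) + 1) · s` when `c² + s² = 1`, `0 < s`. [folklore] -/
theorem aff_kernel_identity {c s : ℝ} (κ m : ℝ) (hs : 0 < s) (h : c ^ 2 + s ^ 2 = 1) :
    κ / (1 + m ^ 2) = κ * s / ((s * m + c) ^ 2 - 2 * c * (s * m + c) + 1) * s := by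
  rw [aff_denominator_eq h m]
  have hm : (1 + m ^ 2) ≠ 0 := by positivity
  have hs' : s ≠ 0 := hs.ne'
  field_simp

/-! ## The affine chart `Φ m = s·m + c` of `ℝ¹` -/

/-- The affine chart is `s • id + c`. [folklore] -/
theorem aff_chart_eq (s c : ℝ) (x : Fin 1 → ℝ) :
    (fun _ : Fin 1 => s * x 0 + c) =
      (s • ContinuousLinearMap.id ℝ (Fin 1 → ℝ)) x + fun _ => c := by
  funext i
  obtain rfl : i = 0 := Fin.fin_one_eq_zero i
  simp

/-- The affine chart has derivative `s • id` everywhere. [folklore] -/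
theorem aff_hasFDerivAt_chart (s c : ℝ) (x : Fin 1 → ℝ) :
    HasFDerivAt (fun y : Fin 1 → ℝ => fun _ : Fin 1 => s * y 0 + c)
      (s • ContinuousLinearMap.id ℝ (Fin 1 → ℝ)) x := by
  have : (fun y : Fin 1 → ℝ => fun _ : Fin 1 => s * y 0 + c) =
      fun y => (s • ContinuousLinearMap.id ℝ (Fin 1 → ℝ)) y + fun _ => c :=
    funext (aff_chart_eq s c)
  rw [this]
  exact (s • ContinuousLinearMap.id ℝ (Fin 1 → ℝ)).hasFDerivAt.add_const _

/-- `|det (s • id_{ℝ¹})| = s` for `0 < s`. [folklore] -/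
theorem aff_abs_det_chartDeriv {s : ℝ} (hs : 0 < s) :
    |(s • ContinuousLinearMap.id ℝ (Fin 1 → ℝ)).det| = s := by
  have : (s • ContinuousLinearMap.id ℝ (Fin 1 → ℝ)).det = s := by
    change LinearMap.det ((s • ContinuousLinearMap.id ℝ (Fin 1 → ℝ) : (Fin 1 → ℝ) →L[ℝ] (Fin 1 → ℝ)) :
      (Fin 1 → ℝ) →ₗ[ℝ] (Fin 1 → ℝ)) = s
    rw [ContinuousLinearMap.toLinearMap_smul, ContinuousLinearMap.coe_id,
      LinearMap.det_smul, LinearMap.det_id, Module.finrank_fin_fun]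
    ring
  rw [this, abs_of_pos hs]

/-- The affine chart is injective for `s ≠ 0`. [folklore] -/
theorem aff_injective_chart {s : ℝ} (hs : s ≠ 0) (c : ℝ) :
    Function.Injective (fun y : Fin 1 → ℝ => fun _ : Fin 1 => s * y 0 + c) := by
  intro x y hxy
  have h0 : s * x 0 + c = s * y 0 + c := congrFun hxy 0
  have h1 : x 0 = y 0 := mul_left_cancel₀ hs (add_right_cancel h0)
  funext i
  obtain rfl : i = 0 := Fin.fin_one_eq_zero i
  exact h1

/-- The affine chart maps `((0−c)/s, (1−c)/s)` ONTO `(0,1)` for `0 < s`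
(preimage point `(y − c)/s`). [folklore] -/
theorem aff_image_chart {s : ℝ} (hs : 0 < s) (c : ℝ) :
    (fun y : Fin 1 → ℝ => fun _ : Fin 1 => s * y 0 + c) ''
        {x : Fin 1 → ℝ | x 0 ∈ Set.Ioo ((0 - c) / s) ((1 - c) / s)} =
      {x : Fin 1 → ℝ | x 0 ∈ Set.Ioo (0:ℝ) 1} := by
  ext y
  constructor
  · rintro ⟨x, hx, rfl⟩
    simp only [mem_setOf_eq, mem_Ioo] at hx ⊢
    obtain ⟨h0, h1⟩ := hx
    rw [div_lt_iff₀ hs] at h0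
    rw [lt_div_iff₀ hs] at h1
    constructor <;> linarith
  · intro hy
    simp only [mem_setOf_eq, mem_Ioo] at hy
    obtain ⟨hy0, hy1⟩ := hy
    refine ⟨fun _ => (y 0 - c) / s, ?_, ?_⟩
    · simp only [mem_setOf_eq, mem_Ioo]
      rw [div_lt_div_iff_of_pos_right hs, div_lt_div_iff_of_pos_right hs]
      constructor <;> linarith
    · funext i
      obtain rfl : i = 0 := Fin.fin_one_eq_zero i
      field_simp
      ring

/-- The affine chart is a `ℚ`-semialgebraic map on any `ℚ`-semialgebraic set: its single
component `s·X₀ + c` has REAL ALGEBRAIC coefficients (`isSemialgebraicFunOn_const_of_isAlgebraic`,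
closure of semialgebraic functions under `+`, `·`). [folklore] -/
theorem aff_isSemialgebraicMapOn_chart {σ : Set (Fin 1 → ℝ)} (hσ : IsSemialgebraic ℚ σ) {c s : ℝ}
    (hc : IsAlgebraic ℚ c) (hs : IsAlgebraic ℚ s) :
    IsSemialgebraicMapOn ℚ σ (fun y : Fin 1 → ℝ => fun _ : Fin 1 => s * y 0 + c) := by
  have hcoord : IsSemialgebraicFunOn ℚ σ (fun y : Fin 1 → ℝ => y 0) := by
    simpa using isSemialgebraicFunOn_aeval hσ (X 0 : MvPolynomial (Fin 1) ℚ)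
  have hcomp : IsSemialgebraicFunOn ℚ σ (fun y : Fin 1 → ℝ => s * y 0 + c) :=
    (IsSemialgebraicFunOn.add_holds
      (IsSemialgebraicFunOn.mul_holds (isSemialgebraicFunOn_const_of_isAlgebraic hσ hs) hcoord)
      (isSemialgebraicFunOn_const_of_isAlgebraic hσ hc)).congr fun y _ => by
        simp only [Pi.add_apply, Pi.mul_apply]
  exact IsSemialgebraicMapOn.of_forall hσ fun _ => hcomp

/-! ## The stub -/

/-- **Registered stub `stub_affineMove`** (line `dirichlet-companion-to-pi` of crux
stmt-KontsevichZagierPeriods-13633, step 3 of Euler reflection, item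
stmt-KontsevichZagierPeriods-3383): the affine substitution `x = s·m + c` (`s = sin θ > 0`,
`c = cos θ`, both real algebraic, `c² + s² = 1`) is ONE rule-(2) move,
`[((0−c)/s, (1−c)/s), κ/(1+m²)] ∼ [(0,1), κ s/(x²−2cx+1)]`; hence any two representations `T`, `A`
with the displayed domains and integrands are `KZ.Equivalent`. (The hypothesis that `κ` is
algebraic is not used: both representations are given.) [cite: KontsevichZagier2001, §1.2] -/
theorem stub_affineMove : ∀ (c s κ : ℝ), IsAlgebraic ℚ c → IsAlgebraic ℚ s → IsAlgebraic ℚ κ → 0 < s → c ^ 2 + s ^ 2 = 1 → ∀ (T A : Literature.NumberTheory.Transcendental.KZ.IntegralRep 1), T.domain = {x | x 0 ∈ Set.Ioo (0:ℝ) 1} → Set.EqOn T.integrand (fun x => κ * s / ((x 0) ^ 2 - 2 * c * (x 0) + 1)) T.domain → A.domain = {x | x 0 ∈ Set.Ioo ((0 - c) / s) ((1 - c) / s)} → Set.EqOn A.integrand (fun x => κ / (1 + (x 0) ^ 2)) A.domain → Literature.NumberTheory.Transcendental.KZ.Equivalent T A := by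
  intro c s κ hc hs_alg _ hs h T A hTd hTi hAd hAi
  -- the chart maps `A.domain` onto `T.domain`
  have himage : T.domain =
      (fun y : Fin 1 → ℝ => fun _ : Fin 1 => s * y 0 + c) '' A.domain := by
    rw [hAd, aff_image_chart hs c, hTd]
  refine Equivalent.symm (changeOfVariablesRel_subset_relations
    ⟨1, A, T, fun y : Fin 1 → ℝ => fun _ : Fin 1 => s * y 0 + c,
      fun _ => s • ContinuousLinearMap.id ℝ (Fin 1 → ℝ),
      aff_isSemialgebraicMapOn_chart A.isSemialgebraic_domain hc hs_alg,
      fun x _ => (aff_hasFDerivAt_chart s c x).hasFDerivWithinAt,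
      (aff_injective_chart hs.ne' c).injOn, himage, fun x hx => ?_, rfl⟩)
  -- the pull-back identity on `A.domain`, Jacobian `|det (s • id)| = s` included
  have hΦx : (fun _ : Fin 1 => s * x 0 + c) ∈ T.domain := himage ▸ mem_image_of_mem _ hx
  rw [hAi hx, hTi hΦx, aff_abs_det_chartDeriv hs]
  exact aff_kernel_identity κ (x 0) hs h

end Summit.KontsevichZagierPeriods.KontsevichZagierPeriods.BetaCancellationLine
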